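import Literature.AlgebraicGeometry.Motives.SmoothHypersurfaceScheme
import Literature.AlgebraicGeometry.Motives.ProjBaseChangeAny
import Mathlib.RingTheory.Smooth.Flat
import Mathlib.RingTheory.Smooth.StandardSmoothCotangent
import HarnessLib

/-!
# Smooth hypersurfaces of `ℙⁿ⁺¹` over a DOMAIN, I: the charts
# (helper for `AnchorsAtGenericHodgeLocusPoints`, stmt-HodgeConjecture-13944)

Route `PadicSemiregularLift` of `HodgeConjecture`, item P2b, Fermat half (B2): the anchor `Xⁿₘ / W(𝔽̄_p)`
is a hypersurface over a RING that must be a smooth proper model (`WittScheme.IsSmoothProperModel`).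
The tree's projective Jacobian criterion (`Motives/SmoothHypersurfaceScheme`) is stated over a field;
its chart computations (`HypersurfaceChartAlgebra`, `HypersurfaceJacobianPresentation`,
`ProjBasicOpenSubscheme`) hold over any commutative ring, and the one field-specific step — "standard
smooth over a field ⇒ reduced", used to see that the ideal of the reduced structure on a chart is `(f)`
itself — is replaced here by its version over a DOMAIN. This file (part I) proves, def-free:

* `isReduced_of_isStandardSmoothOfRelativeDimension_of_isDomain` — a standard smooth algebra over a
  domain is reduced (flat, hence embedded in its base change to the fraction field, which is standard
  smooth over a field and therefore reduced, Stacks 056T);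
* `exists_mem_basicOpen_of_mem_zeroLocus` — the `D₊(xᵢ ∂ⱼF)` cover `V₊(F)` for a nonsingular form over
  any ring (Hartshorne I Ex. 5.8 (c));
* `smoothOfRelativeDimension_subschemePiece` — over a domain, each chart of the reduced cut-out `V₊(F)`
  (Mathlib: the `subscheme` of the vanishing ideal sheaf of the closed set `V₊(F)`) over `D₊(xᵢ ∂ⱼF)`
  is smooth of relative dimension `n` (Hartshorne I Ex. 5.8 (b), III Thm. 10.2).

Part II (`…SmoothCutOut.lean`) glues the charts. No notation and no definitions are introduced (the
vanishing ideal sheaf of `V₊(F)` is written out), so that the statements are literally about the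
carriers `Crystalline.projectiveSpaceOver` / `Crystalline.IsFermatLift` consume.

References: R. Hartshorne, *Algebraic Geometry* (1977), I Ex. 5.8, II Example 3.2.6, III Thm. 10.2
[Hartshorne1977]; The Stacks project, Tag 056T [StacksProject].
-/

-- the summit-side namespace `Summit.HodgeConjecture.HodgeConjecture.…` (summit = sub-problem, D-0017)
-- repeats a component by design; the linter would flag every declaration.
set_option linter.dupNamespace false

noncomputable section

open CategoryTheory CategoryTheory.Limits AlgebraicGeometry TopologicalSpace MvPolynomial
  HomogeneousLocalization
open scoped TensorProduct
open Literature.AlgebraicGeometry.Motives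
open Literature.AlgebraicGeometry.Motives.ProjectiveSpace Literature.AlgebraicGeometry.Motives.ProjSubscheme
  Literature.AlgebraicGeometry.Motives.SmoothHypersurface

universe u

namespace Summit.HodgeConjecture.HodgeConjecture.Theorems.AnchorsAtGenericHodgeLocusPoints

/-- **A standard smooth algebra over a domain is reduced**: it is flat over `O` (smooth ⇒ flat), so
it embeds into its base change to the fraction field `K`, which is standard smooth over the FIELD `K`,
hence reduced (Stacks 056T, the tree's `isReduced_of_isStandardSmoothOfRelativeDimension`).
[cite: StacksProject, Tag 056T] -/
theorem isReduced_of_isStandardSmoothOfRelativeDimension_of_isDomain (O : Type u) [CommRing O]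
    [IsDomain O] (S : Type u) [CommRing S] [Algebra O S] (n : ℕ)
    [Algebra.IsStandardSmoothOfRelativeDimension n O S] : IsReduced S := by
  let K := FractionRing O
  haveI : Algebra.IsStandardSmoothOfRelativeDimension n K (K ⊗[O] S) := inferInstance
  haveI : IsReduced (K ⊗[O] S) := isReduced_of_isStandardSmoothOfRelativeDimension K n
  haveI : Algebra.IsStandardSmooth O S :=
    Algebra.IsStandardSmoothOfRelativeDimension.isStandardSmooth n
  haveI : Algebra.Smooth O S := inferInstance
  haveI : Module.Flat O S := inferInstance
  -- `S → K ⊗ S` is `(O → K) ⊗ S` precomposed with `S ≅ O ⊗ S`, injective by flatness of `S`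
  have hinj : Function.Injective (Algebra.TensorProduct.includeRight : S →ₐ[O] K ⊗[O] S) := by
    have h1 : Function.Injective ((Algebra.linearMap O K).rTensor S) :=
      Module.Flat.rTensor_preserves_injective_linearMap _ (IsFractionRing.injective O K)
    have h2 : (Algebra.TensorProduct.includeRight : S →ₐ[O] K ⊗[O] S) =
        fun s => (Algebra.linearMap O K).rTensor S ((TensorProduct.lid O S).symm s) := by
      ext s
      simp [Algebra.TensorProduct.includeRight_apply]
    rw [h2]
    exact h1.comp (TensorProduct.lid O S).symm.injective
  exact isReduced_of_injective (Algebra.TensorProduct.includeRight : S →ₐ[O] K ⊗[O] S) hinj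

section Cover

variable {O : Type u} [CommRing O] {n : ℕ} (F : MvPolynomial (Fin (n + 2)) O) {d : ℕ}
  (hF : F.IsHomogeneous d)

include hF in
/-- **The `D₊(xᵢ · ∂F/∂x_{i.succAbove j})` cover `V₊(F)`** for a nonsingular form `F` over any
commutative ring (Hartshorne I Ex. 5.8 (c); Euler's lemma `Σ xⱼ ∂ⱼF = d·F`, and the variables generate
the irrelevant ideal, `ProjBaseChangeRing.irrelevant_le_span_X`). Ring-base copy of the tree's
`SmoothHypersurface.exists_mem_basicOpen_of_mem_zeroLocus`. [cite: Hartshorne1977, I Ex. 5.8] -/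
theorem exists_mem_basicOpen_of_mem_zeroLocus (hJ : IsNonsingularForm O F)
    (p : letI := MvPolynomial.gradedAlgebra (σ := Fin (n + 2)) (R := O)
      Proj (MvPolynomial.homogeneousSubmodule (Fin (n + 2)) O))
    (hp : letI := MvPolynomial.gradedAlgebra (σ := Fin (n + 2)) (R := O)
      p ∈ ProjectiveSpectrum.zeroLocus (MvPolynomial.homogeneousSubmodule (Fin (n + 2)) O) {F}) :
    letI := MvPolynomial.gradedAlgebra (σ := Fin (n + 2)) (R := O)
    ∃ ij : Fin (n + 2) × Fin (n + 1),
      p ∈ Proj.basicOpen (MvPolynomial.homogeneousSubmodule (Fin (n + 2)) O)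
        (X ij.1 * pderiv (ij.1.succAbove ij.2) F) := by
  letI := MvPolynomial.gradedAlgebra (σ := Fin (n + 2)) (R := O)
  have hFp : F ∈ p.asHomogeneousIdeal := Set.singleton_subset_iff.mp hp
  -- not all variables lie in `𝔭`
  have hXall : ¬ ∀ i, (X i : MvPolynomial (Fin (n + 2)) O) ∈ p.asHomogeneousIdeal := by
    intro h
    refine p.not_irrelevant_le fun a ha => ?_
    exact Ideal.span_le.mpr (Set.range_subset_iff.mpr h)
      (ProjBaseChangeRing.irrelevant_le_span_X O ha)
  by_contra! H
  simp only [Proj.mem_basicOpen, not_not] at H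
  obtain ⟨i₀, hi₀⟩ : ∃ i₀, (X i₀ : MvPolynomial (Fin (n + 2)) O) ∉ p.asHomogeneousIdeal := by
    by_contra! h
    exact hXall h
  have hsA : ∀ j : Fin (n + 1), pderiv (i₀.succAbove j) F ∈ p.asHomogeneousIdeal := fun j =>
    (p.isPrime.mem_or_mem (H ⟨i₀, j⟩)).resolve_left hi₀
  -- Euler: `x_{i₀} ∂_{i₀} F = d F - Σ_{j} x_{sA j} ∂_{sA j} F ∈ 𝔭`
  have hi₀' : pderiv i₀ F ∈ p.asHomogeneousIdeal := by
    have heuler := hF.sum_X_mul_pderiv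
    rw [Fin.sum_univ_succAbove _ i₀] at heuler
    have h1 : X i₀ * pderiv i₀ F =
        d • F - ∑ j : Fin (n + 1), X (i₀.succAbove j) * pderiv (i₀.succAbove j) F := by
      rw [← heuler]; ring
    have hmem : X i₀ * pderiv i₀ F ∈ p.asHomogeneousIdeal := by
      rw [h1]
      exact Ideal.sub_mem _ (nsmul_mem hFp d)
        (Ideal.sum_mem _ fun j _ => Ideal.mul_mem_left _ _ (hsA j))
    exact (p.isPrime.mem_or_mem hmem).resolve_left hi₀
  have hall : ∀ s, pderiv s F ∈ p.asHomogeneousIdeal := fun s => by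
    rcases Fin.eq_self_or_eq_succAbove i₀ s with rfl | ⟨j, rfl⟩
    · exact hi₀'
    · exact hsA j
  exact hXall (hJ _ p.isPrime hFp hall)

end Cover

/-! ### The charts of the reduced cut-out `V₊(F)` over a domain are standard smooth -/

section Chart

variable {O : Type u} [CommRing O] [IsDomain O] {n : ℕ} (F : MvPolynomial (Fin (n + 2)) O) {d : ℕ}
  (hF : F.IsHomogeneous d) (i : Fin (n + 2)) (j : Fin (n + 1))

include hF in
/-- **The chart of the reduced cut-out `V₊(F)` over `D₊(xᵢ ∂ⱼF)` is smooth of relative dimension `n`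
over the domain `O`** (`F` homogeneous of degree `d ≥ 1`; Hartshorne I Ex. 5.8 (b), III Thm. 10.2):
read in `S = (O[x]_{xᵢh})₀ = O[y][1/h(xᵢ := 1)]`, `h = ∂ⱼF`, the ideal of the reduced structure (the
vanishing ideal sheaf of `V₊(F)`, evaluated on `D₊(xᵢh)`) is the radical of `(f)`, `f = F(xᵢ := 1)`;
`S/(f)` is standard smooth of relative dimension `n` over `O` (presentation `O[t, y]/(f, t ∂ⱼf − 1)`),
hence reduced (`O` a domain), so `(f)` is radical and the chart `Spec (Γ(D₊(xᵢh))/𝓘) → Spec O` is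
`Spec` of a standard smooth ring map. [cite: Hartshorne1977, I Ex. 5.8 and III Thm. 10.2] -/
theorem smoothOfRelativeDimension_subschemePiece (hd : 0 < d) :
    letI := MvPolynomial.gradedAlgebra (σ := Fin (n + 2)) (R := O)
    SmoothOfRelativeDimension n
      (subschemePiece
          (Scheme.IdealSheafData.vanishingIdeal
            (⟨ProjectiveSpectrum.zeroLocus (homogeneousSubmodule (Fin (n + 2)) O) {F},
              ProjectiveSpectrum.isClosed_zeroLocus _ _⟩ :
              Closeds (Proj (homogeneousSubmodule (Fin (n + 2)) O))))
          (affineBasicOpen (homogeneousSubmodule (Fin (n + 2)) O) (X i * pderiv (i.succAbove j) F)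
            (SetLike.mul_mem_graded (X_mem i) hF.pderiv) (SmoothHypersurface.one_add_pos d)) ≫
        (Scheme.IdealSheafData.vanishingIdeal
            (⟨ProjectiveSpectrum.zeroLocus (homogeneousSubmodule (Fin (n + 2)) O) {F},
              ProjectiveSpectrum.isClosed_zeroLocus _ _⟩ :
              Closeds (Proj (homogeneousSubmodule (Fin (n + 2)) O)))).subschemeι ≫
          ProjBaseChangeRing.projToSpec (Fin (n + 2)) O) := by
  letI := MvPolynomial.gradedAlgebra (σ := Fin (n + 2)) (R := O)
  letI := ProjBaseChange.algebraBase (homogeneousSubmodule (Fin (n + 2)) O)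
  haveI := ProjBaseChange.isScalarTower_localization (homogeneousSubmodule (Fin (n + 2)) O)
  have hxh : X i * pderiv (i.succAbove j) F ∈ homogeneousSubmodule (Fin (n + 2)) O (1 + (d - 1)) :=
    SetLike.mul_mem_graded (X_mem i) hF.pderiv
  have he : pderiv (i.succAbove j) F ∈ homogeneousSubmodule (Fin (n + 2)) O (d - 1) := hF.pderiv
  -- (1) the ideal of the reduced structure on the chart is the radical of `(f)`, `f = F(xᵢ := 1)`
  have hrad :
      (Scheme.IdealSheafData.vanishingIdeal
            (⟨ProjectiveSpectrum.zeroLocus (homogeneousSubmodule (Fin (n + 2)) O) {F},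
              ProjectiveSpectrum.isClosed_zeroLocus _ _⟩ :
              Closeds (Proj (homogeneousSubmodule (Fin (n + 2)) O)))).ideal
          (affineBasicOpen (homogeneousSubmodule (Fin (n + 2)) O) (X i * pderiv (i.succAbove j) F)
            (SetLike.mul_mem_graded (X_mem i) hF.pderiv) (SmoothHypersurface.one_add_pos d)) =
        Ideal.map (Proj.awayToSection (homogeneousSubmodule (Fin (n + 2)) O)
            (X i * pderiv (i.succAbove j) F)).hom
          (Ideal.span {chartMap O i he (dehomogenize O i F)}).radical := by
    rw [vanishingIdeal_ideal_affineBasicOpen]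
    congr 1
    refine (congrArg PrimeSpectrum.vanishingIdeal (awayι_mul_preimage_zeroLocus
      (homogeneousSubmodule (Fin (n + 2)) O) (X_mem i) Nat.one_pos hF.pderiv rfl hF hd)).trans ?_
    rw [← chartMap_dehomogenize O i _ F hF, ← PrimeSpectrum.zeroLocus_span,
      PrimeSpectrum.vanishingIdeal_zeroLocus_eq_radical]
  -- (2) `S/(f)` is standard smooth of relative dimension `n` over `O`, hence reduced: `(f)` radical
  have hstd : Algebra.IsStandardSmoothOfRelativeDimension n O
      (Away (homogeneousSubmodule (Fin (n + 2)) O) (X i * pderiv (i.succAbove j) F) ⧸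
        Ideal.span {chartMap O i he (dehomogenize O i F)}) := by
    letI : Algebra (MvPolynomial (Fin (n + 1)) O)
        (Away (homogeneousSubmodule (Fin (n + 2)) O) (X i * pderiv (i.succAbove j) F)) :=
      (chartMap O i he).toRingHom.toAlgebra
    haveI : IsScalarTower O (MvPolynomial (Fin (n + 1)) O)
        (Away (homogeneousSubmodule (Fin (n + 2)) O) (X i * pderiv (i.succAbove j) F)) :=
      IsScalarTower.of_algebraMap_eq fun r => ((chartMap O i he).commutes r).symm
    haveI : IsLocalization.Away (pderiv j (dehomogenize O i F))
        (Away (homogeneousSubmodule (Fin (n + 2)) O) (X i * pderiv (i.succAbove j) F)) := by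
      rw [pderiv_dehomogenize]
      exact isLocalization_chartMap O i he
    exact isStandardSmoothOfRelativeDimension_quotient (dehomogenize O i F) j _
  have hradical : (Ideal.span {chartMap O i he (dehomogenize O i F)}).radical =
      Ideal.span {chartMap O i he (dehomogenize O i F)} := by
    haveI := hstd
    haveI : IsReduced (Away (homogeneousSubmodule (Fin (n + 2)) O) (X i * pderiv (i.succAbove j) F) ⧸
        Ideal.span {chartMap O i he (dehomogenize O i F)}) :=
      isReduced_of_isStandardSmoothOfRelativeDimension_of_isDomain O _ n
    exact Ideal.radical_eq_iff.mpr ((Ideal.isRadical_iff_quotient_reduced _).mpr this)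
  have hideal :
      (Scheme.IdealSheafData.vanishingIdeal
            (⟨ProjectiveSpectrum.zeroLocus (homogeneousSubmodule (Fin (n + 2)) O) {F},
              ProjectiveSpectrum.isClosed_zeroLocus _ _⟩ :
              Closeds (Proj (homogeneousSubmodule (Fin (n + 2)) O)))).ideal
          (affineBasicOpen (homogeneousSubmodule (Fin (n + 2)) O) (X i * pderiv (i.succAbove j) F)
            (SetLike.mul_mem_graded (X_mem i) hF.pderiv) (SmoothHypersurface.one_add_pos d)) =
        Ideal.map (Proj.awayToSection (homogeneousSubmodule (Fin (n + 2)) O)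
            (X i * pderiv (i.succAbove j) F)).hom
          (Ideal.span {chartMap O i he (dehomogenize O i F)}) := by
    rw [hrad, hradical]
  -- (3) the structure morphism of the chart is `Spec` of `χ : O → S ≅ Γ(D₊) → Γ(D₊)/𝓘` …
  let χ : O →+*
      Γ(Proj (homogeneousSubmodule (Fin (n + 2)) O),
          ((affineBasicOpen (homogeneousSubmodule (Fin (n + 2)) O) (X i * pderiv (i.succAbove j) F)
            (SetLike.mul_mem_graded (X_mem i) hF.pderiv) (SmoothHypersurface.one_add_pos d)) : (Proj (homogeneousSubmodule (Fin (n + 2)) O)).Opens)) ⧸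
        (Scheme.IdealSheafData.vanishingIdeal
            (⟨ProjectiveSpectrum.zeroLocus (homogeneousSubmodule (Fin (n + 2)) O) {F},
              ProjectiveSpectrum.isClosed_zeroLocus _ _⟩ :
              Closeds (Proj (homogeneousSubmodule (Fin (n + 2)) O)))).ideal
          (affineBasicOpen (homogeneousSubmodule (Fin (n + 2)) O) (X i * pderiv (i.succAbove j) F)
            (SetLike.mul_mem_graded (X_mem i) hF.pderiv) (SmoothHypersurface.one_add_pos d)) :=
    (Ideal.Quotient.mk _).comp ((Proj.awayToSection (homogeneousSubmodule (Fin (n + 2)) O)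
      (X i * pderiv (i.succAbove j) F)).hom.comp
        (algebraMap O (Away (homogeneousSubmodule (Fin (n + 2)) O) (X i * pderiv (i.succAbove j) F))))
  have hhom :
      subschemePiece
            (Scheme.IdealSheafData.vanishingIdeal
            (⟨ProjectiveSpectrum.zeroLocus (homogeneousSubmodule (Fin (n + 2)) O) {F},
              ProjectiveSpectrum.isClosed_zeroLocus _ _⟩ :
              Closeds (Proj (homogeneousSubmodule (Fin (n + 2)) O))))
            (affineBasicOpen (homogeneousSubmodule (Fin (n + 2)) O) (X i * pderiv (i.succAbove j) F)
            (SetLike.mul_mem_graded (X_mem i) hF.pderiv) (SmoothHypersurface.one_add_pos d)) ≫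
          (Scheme.IdealSheafData.vanishingIdeal
            (⟨ProjectiveSpectrum.zeroLocus (homogeneousSubmodule (Fin (n + 2)) O) {F},
              ProjectiveSpectrum.isClosed_zeroLocus _ _⟩ :
              Closeds (Proj (homogeneousSubmodule (Fin (n + 2)) O)))).subschemeι ≫
            ProjBaseChangeRing.projToSpec (Fin (n + 2)) O =
        Spec.map (CommRingCat.ofHom χ) := by
    rw [reassoc_of% subschemePiece_ι_toSpecZero (homogeneousSubmodule (Fin (n + 2)) O)
      (X i * pderiv (i.succAbove j) F) hxh (SmoothHypersurface.one_add_pos d)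
      (Scheme.IdealSheafData.vanishingIdeal
            (⟨ProjectiveSpectrum.zeroLocus (homogeneousSubmodule (Fin (n + 2)) O) {F},
              ProjectiveSpectrum.isClosed_zeroLocus _ _⟩ :
              Closeds (Proj (homogeneousSubmodule (Fin (n + 2)) O)))),
      ← Spec.map_comp]
    rfl
  -- (4) … and `χ` is standard smooth of relative dimension `n` (transport along `S/(f) ≅ Γ(D₊)/𝓘`)
  have hχ : χ.IsStandardSmoothOfRelativeDimension n := by
    let e : Away (homogeneousSubmodule (Fin (n + 2)) O) (X i * pderiv (i.succAbove j) F) ≃+*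
        Γ(Proj (homogeneousSubmodule (Fin (n + 2)) O),
          ((affineBasicOpen (homogeneousSubmodule (Fin (n + 2)) O) (X i * pderiv (i.succAbove j) F)
            (SetLike.mul_mem_graded (X_mem i) hF.pderiv) (SmoothHypersurface.one_add_pos d)) : (Proj (homogeneousSubmodule (Fin (n + 2)) O)).Opens)) :=
      (Proj.basicOpenIsoAway (homogeneousSubmodule (Fin (n + 2)) O) (X i * pderiv (i.succAbove j) F)
        hxh (SmoothHypersurface.one_add_pos d)).commRingCatIsoToRingEquiv
    have hIJ :
        (Scheme.IdealSheafData.vanishingIdeal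
            (⟨ProjectiveSpectrum.zeroLocus (homogeneousSubmodule (Fin (n + 2)) O) {F},
              ProjectiveSpectrum.isClosed_zeroLocus _ _⟩ :
              Closeds (Proj (homogeneousSubmodule (Fin (n + 2)) O)))).ideal
            (affineBasicOpen (homogeneousSubmodule (Fin (n + 2)) O) (X i * pderiv (i.succAbove j) F)
            (SetLike.mul_mem_graded (X_mem i) hF.pderiv) (SmoothHypersurface.one_add_pos d)) =
          Ideal.map
            (e : Away (homogeneousSubmodule (Fin (n + 2)) O) (X i * pderiv (i.succAbove j) F) →+* _)
            (Ideal.span {chartMap O i he (dehomogenize O i F)}) := by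
      rw [hideal]
      rfl
    let E := Ideal.quotientEquiv _ _ e hIJ
    haveI := hstd
    have hQ : (algebraMap O (Away (homogeneousSubmodule (Fin (n + 2)) O)
        (X i * pderiv (i.succAbove j) F) ⧸ Ideal.span {chartMap O i he (dehomogenize O i F)}))
          |>.IsStandardSmoothOfRelativeDimension n :=
      (RingHom.isStandardSmoothOfRelativeDimension_algebraMap n).mpr inferInstance
    have hcomp : χ = E.toRingHom.comp (algebraMap O (Away (homogeneousSubmodule (Fin (n + 2)) O)
        (X i * pderiv (i.succAbove j) F) ⧸ Ideal.span {chartMap O i he (dehomogenize O i F)})) :=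
      RingHom.ext fun r => rfl
    rw [hcomp]
    exact RingHom.isStandardSmoothOfRelativeDimension_respectsIso.1 _ E hQ
  rw [hhom, HasRingHomProperty.Spec_iff (P := @SmoothOfRelativeDimension n)]
  exact RingHom.locally_of RingHom.isStandardSmoothOfRelativeDimension_respectsIso _ hχ

end Chart

end Summit.HodgeConjecture.HodgeConjecture.Theorems.AnchorsAtGenericHodgeLocusPoints

end
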